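import Summits.Ventures.DiscreteObjects.Hadamard.ConferenceGraph333Order11RankTest
import Summits.Ventures.DiscreteObjects.Hadamard.IntertwinedTraceAverage

/-!
# The averaged (character) partial-Hadamard rank test at order `11` (kernel instance)

Framing: lottery ticket; floor = certified bounds/negative ranges.  Cell pub-namedobj (venture DiscreteObjects),
target (H) = `H(668)`, hadamard gen 32.  KERNEL INSTANCE of the averaged rank test (abstract core
`IntertwinedTraceAverage.trace_pow_sub_sum_nonneg_of_intertwining`, gen 31), complementing the per-element bound
`ConferenceGraph333Order11RankTest.aut_order11_commuting_rank_test` (`(t − f_F)² ≤ 9`).  Let `ρ` be an automorphism of order `11`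
of a hypothetical srg(333,166,82,83) (`25` fixed vertices, `28` orbits of size `11`) and let `σ` commute with `ρ`, `σ^N = 1`.  With the
fixed-vertex / orbit incidence matrix `B` (`B Bᵀ = 7(I + J)`), `K = (I − J/26)/7` and the permutation matrices `R`, `P` of `σ` on `Fix ρ` and on
the orbits (`B P = R B`), the powers `Pʲ`, `Rʲ` are the permutation matrices of `σʲ`; the abstract averaged test gives
* `perm01_mul_perm01`, `perm01_pow` — products / powers of `0/1` permutation matrices;
* **`aut_order11_commuting_character_test`** — `0 ≤ Σ_{j<N} (t₁₁(σʲ) − 11·f_F(σʲ))`, where `t₁₁(τ) = #{x : ρx ≠ x, τx ∈ ⟨ρ⟩x}` (`= 11 ×` the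
  number of `τ`-invariant `ρ`-orbits) and `f_F(τ) = #{x : τx = x, ρx = x}`; i.e. the multiplicity of the trivial character of `⟨σ⟩` on
  `ker B` is non-negative.
Census use (next file): an element of order `33` has the unique cycle type `33⁸·11⁴·3⁸·1¹` (the type `33⁸·11⁴·3⁶·1⁷` has Σ = −363 < 0).
WORDS: structure of a HYPOTHETICAL object (nothing about H(668) is excluded); ours (PROVISIONAL).  No `sorry`, no new definitions.
-/

namespace Summit.Ventures.DiscreteObjects.Hadamard

open Finset Matrix

section permMatrixPow
variable {α : Type*} [Fintype α] [DecidableEq α]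

/-- `M_e * M_{e'} = M_{e' * e}` for the `0/1` matrices `M_e = ([e a = b])_{a,b}` of permutations. -/
theorem perm01_mul_perm01 (e e' : Equiv.Perm α) :
    (Matrix.of fun a b : α => if e a = b then (1 : ℚ) else 0) * (Matrix.of fun a b : α => if e' a = b then (1 : ℚ) else 0) =
      Matrix.of fun a b : α => if (e' * e) a = b then (1 : ℚ) else 0 := by
  ext a c
  rw [perm01_mul_left]
  simp only [Matrix.of_apply, Equiv.Perm.mul_apply]
  split_ifs <;> rfl

/-- powers: `(M_e)ʲ = M_{eʲ}`. -/
theorem perm01_pow (e : Equiv.Perm α) (j : ℕ) :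
    (Matrix.of fun a b : α => if e a = b then (1 : ℚ) else 0) ^ j = Matrix.of fun a b : α => if (e ^ j) a = b then (1 : ℚ) else 0 := by
  induction j with
  | zero =>
    rw [pow_zero, pow_zero]
    ext a b
    simp only [Matrix.one_apply, Matrix.of_apply, Equiv.Perm.one_apply]
    split_ifs <;> rfl
  | succ j ih =>
    rw [pow_succ', ih, perm01_mul_perm01, ← pow_succ]

end permMatrixPow

section characterTest11
variable {V : Type*} [Fintype V] [DecidableEq V]

/-- **Averaged partial-Hadamard rank test at order `11`.**  For `ρ` of order `11`, `σ` commuting with `ρ` (both automorphisms) and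
`σ^N = 1` (`N > 0`): `0 ≤ Σ_{j<N} ( #{x : ρx ≠ x, σʲx ∈ ⟨ρ⟩x} − 11 · #{x : σʲ x = x ∧ ρ x = x} )`. -/
theorem aut_order11_commuting_character_test (hV : Fintype.card V = 333) (A : Matrix V V ℤ)
    (h01 : ∀ x y, A x y = 0 ∨ A x y = 1) (hsymm : ∀ x y, A y x = A x y) (hdiag : ∀ x, A x x = 0)
    (hk : ∀ x, ∑ y, A x y = 166) (hsrg : ∀ x y, ∑ z, A x z * A z y = 83 * (1 + (if x = y then 1 else 0)) - A x y)
    (ρ : Equiv.Perm V) (hρ : ρ ^ 11 = 1) (hρ1 : ρ ≠ 1) (hAρ : ∀ x y, A (ρ x) (ρ y) = A x y)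
    (σ : Equiv.Perm V) (hc : σ * ρ = ρ * σ) (hAσ : ∀ x y, A (σ x) (σ y) = A x y)
    {N : ℕ} (hN : 0 < N) (hσN : σ ^ N = 1) :
    0 ≤ ∑ j ∈ Finset.range N,
      (((univ.filter fun x => ρ x ≠ x ∧ (σ ^ j) x ∈ (Finset.range 11).image (fun k => (ρ ^ k) x)).card : ℤ)
        - 11 * ((univ.filter fun x => (σ ^ j) x = x ∧ ρ x = x).card : ℤ)) := by
  classical
  have hp : Nat.Prime 11 := by norm_num
  -- commuting facts on points (for every power of σ)
  have hcx : ∀ x, σ (ρ x) = ρ (σ x) := fun x => by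
    have := congrArg (fun g : Equiv.Perm V => g x) hc; simpa using this
  have hcomm : ∀ j : ℕ, σ ^ j * ρ = ρ * σ ^ j := fun j => ((show Commute σ ρ from hc).pow_left j).eq
  have hcxj : ∀ (j : ℕ) x, (σ ^ j) (ρ x) = ρ ((σ ^ j) x) := fun j x => by
    have := congrArg (fun g : Equiv.Perm V => g x) (hcomm j); simpa using this
  have hckj : ∀ (j k : ℕ) x, (σ ^ j) ((ρ ^ k) x) = (ρ ^ k) ((σ ^ j) x) := by
    intro j k; induction k with
    | zero => intro x; simp
    | succ k ih => intro x; rw [pow_succ', Equiv.Perm.mul_apply, Equiv.Perm.mul_apply, hcxj, ih]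
  have hck : ∀ (k : ℕ) x, σ ((ρ ^ k) x) = (ρ ^ k) (σ x) := fun k x => by
    have := hckj 1 k x; rwa [pow_one] at this
  -- orbits of ρ
  set orb : V → Finset V := fun x => (Finset.range 11).image (fun k => (ρ ^ k) x) with horb
  have horb_mem : ∀ x y, y ∈ orb x ↔ orb y = orb x := fun x y => mem_orbP_iff ρ (by norm_num) hρ x y
  have horb_self : ∀ x, x ∈ orb x := fun x => (horb_mem x x).mpr rfl
  have horb_pow : ∀ (k : ℕ) x, orb ((ρ ^ k) x) = orb x := fun k x =>
    (horb_mem x _).mp (Finset.mem_image.mpr ⟨k % 11, Finset.mem_range.mpr (Nat.mod_lt _ (by norm_num)),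
      (perm_pow_apply_mod ρ hρ k x).symm⟩)
  have horb_moved : ∀ x, ρ x ≠ x → ∀ z ∈ orb x, ρ z ≠ z := by
    intro x hx z hz h
    obtain ⟨k, -, rfl⟩ := Finset.mem_image.mp hz
    exact hx ((ρ ^ k).injective (by rw [perm_pow_apply_comm]; exact h))
  have horb_τ : ∀ (j : ℕ) x, orb ((σ ^ j) x) = (orb x).image (σ ^ j) := by
    intro j x; simp only [horb]; rw [Finset.image_image]
    refine Finset.image_congr fun k _ => ?_
    show (ρ ^ k) ((σ ^ j) x) = ((σ ^ j) ∘ fun k => (ρ ^ k) x) k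
    simp [hckj]
  have horb_σ : ∀ x, orb (σ x) = (orb x).image σ := fun x => by
    have := horb_τ 1 x; rwa [pow_one] at this
  -- the orbit index type
  set S := (univ.filter fun x => ρ x ≠ x).image orb with hS
  set ι := {j : Finset V // j ∈ S} with hι
  have hrep : ∀ i : ι, ∃ x, ρ x ≠ x ∧ orb x = i.1 := fun i => by
    obtain ⟨x, hx, hxe⟩ := Finset.mem_image.mp i.2
    exact ⟨x, (Finset.mem_filter.mp hx).2, hxe⟩
  choose rep hrep_moved hrep_orb using hrep
  have hrep_mem : ∀ i : ι, rep i ∈ i.1 := fun i => by rw [← hrep_orb i]; exact horb_self _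
  -- fixed points as a subtype
  have hf25 := aut_order11_fixed hV A h01 hsymm hdiag hk hsrg ρ hρ hρ1 hAρ
  have hFcard : Fintype.card {y : V // ρ y = y} = 25 := by rw [Fintype.card_subtype, hf25]
  -- sums over the moved vertices = 11 · sums over orbit representatives, for orbit-invariant functions
  have hdisj : Set.PairwiseDisjoint (↑(univ : Finset ι)) (fun i : ι => (i.1 : Finset V)) := by
    intro i _ i' _ hne
    show Disjoint i.1 i'.1
    rw [Finset.disjoint_left]
    intro z hz hz'
    apply hne; apply Subtype.ext
    rw [← hrep_orb i] at hz; rw [← hrep_orb i'] at hz'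
    rw [← hrep_orb i, ← hrep_orb i', ← (horb_mem _ _).mp hz, ← (horb_mem _ _).mp hz']
  have hcover : (univ.filter fun x => ρ x ≠ x) = (univ : Finset ι).biUnion (fun i => i.1) := by
    ext z
    rw [Finset.mem_filter, Finset.mem_biUnion]
    constructor
    · rintro ⟨-, hz⟩
      refine ⟨⟨orb z, Finset.mem_image.mpr ⟨z, Finset.mem_filter.mpr ⟨Finset.mem_univ _, hz⟩, rfl⟩⟩, Finset.mem_univ _, horb_self z⟩
    · rintro ⟨i, -, hz⟩
      rw [← hrep_orb i] at hz
      exact ⟨Finset.mem_univ _, horb_moved _ (hrep_moved i) z hz⟩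
  have hsum : ∀ g : V → ℚ, (∀ x (k : ℕ), ρ x ≠ x → g ((ρ ^ k) x) = g x) →
      ∑ z ∈ univ.filter (fun x => ρ x ≠ x), g z = 11 * ∑ i : ι, g (rep i) := by
    intro g hg
    rw [hcover, Finset.sum_biUnion hdisj, Finset.mul_sum]
    refine Finset.sum_congr rfl fun i _ => ?_
    rw [← hrep_orb i]
    simp only [horb]
    rw [Finset.sum_image (orbP_injOn ρ hp hρ (rep i) (hrep_moved i))]
    rw [Finset.sum_congr rfl fun k _ => hg (rep i) k (hrep_moved i), Finset.sum_const, Finset.card_range, nsmul_eq_mul]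
    norm_num
  have hιcard : (Fintype.card ι : ℚ) = 28 := by
    have h1 := hsum (fun _ => 1) (fun _ _ _ => rfl)
    rw [Finset.sum_const, Finset.sum_const, Finset.card_univ, nsmul_eq_mul, nsmul_eq_mul, mul_one, mul_one] at h1
    have hm : ((univ.filter fun x => ρ x ≠ x).card : ℚ) = 308 := by
      have h := Finset.card_filter_add_card_filter_not (s := (univ : Finset V)) (fun x => ρ x ≠ x)
      rw [Finset.card_univ, hV] at h
      have e : (univ.filter fun x => ¬ (ρ x ≠ x)) = univ.filter fun x => ρ x = x := Finset.filter_congr fun x _ => by simp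
      rw [e, hf25] at h
      have : (univ.filter fun x => ρ x ≠ x).card = 308 := by omega
      exact_mod_cast this
    rw [hm] at h1
    linarith
  -- the induced permutations
  have hkey : ∀ y, ρ (σ y) = σ y ↔ ρ y = y := fun y => by
    constructor
    · intro hy; rw [← hcx] at hy; exact σ.injective hy
    · intro hy; rw [← hcx, hy]
  set σF : Equiv.Perm {y : V // ρ y = y} := σ.subtypePerm hkey with hσF
  have hSperm : ∀ j : Finset V, j ∈ S ↔ σ.finsetCongr j ∈ S := by
    intro j
    rw [Equiv.finsetCongr_apply, Finset.map_eq_image]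
    constructor
    · intro hj
      obtain ⟨x, hx, rfl⟩ := Finset.mem_image.mp hj
      have hxm := (Finset.mem_filter.mp hx).2
      refine Finset.mem_image.mpr ⟨σ x, Finset.mem_filter.mpr ⟨Finset.mem_univ _, fun h => hxm ?_⟩, ?_⟩
      · rw [← hcx] at h; exact σ.injective h
      · show orb (σ x) = Finset.image (⇑σ.toEmbedding) (orb x)
        rw [horb_σ]; rfl
    · intro hj
      obtain ⟨x', hx', hxe⟩ := Finset.mem_image.mp hj
      have hx'm := (Finset.mem_filter.mp hx').2
      refine Finset.mem_image.mpr ⟨σ.symm x', Finset.mem_filter.mpr ⟨Finset.mem_univ _, fun h => hx'm ?_⟩, ?_⟩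
      · have h2 := congrArg σ h
        rwa [hcx, Equiv.apply_symm_apply] at h2
      · have e1 : (orb (σ.symm x')).image σ = orb x' := by rw [← horb_σ, Equiv.apply_symm_apply]
        have e2 : (orb (σ.symm x')).image σ = Finset.image (⇑σ.toEmbedding) j := by rw [e1, hxe]
        exact Finset.image_injective σ.injective e2
  set πσ : Equiv.Perm ι := Equiv.Perm.subtypePerm (σ.finsetCongr : Equiv.Perm (Finset V)) (fun j => (hSperm j).symm)
    with hπσ
  have hπσ_val : ∀ i : ι, (πσ i).1 = i.1.image σ := fun i => by
    show (σ.finsetCongr i.1) = i.1.image σ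
    rw [Equiv.finsetCongr_apply, Finset.map_eq_image]; rfl
  have hσF_val : ∀ y : {y : V // ρ y = y}, (σF y).1 = σ y.1 := fun y => rfl
  -- powers of the induced permutations are induced by the powers of σ
  have hπσ_pow_val : ∀ (j : ℕ) (i : ι), ((πσ ^ j) i).1 = i.1.image (σ ^ j) := by
    intro j; induction j with
    | zero => intro i; rw [pow_zero, pow_zero, Equiv.Perm.one_apply, Equiv.Perm.coe_one, Finset.image_id]
    | succ j ih =>
      intro i
      rw [pow_succ', Equiv.Perm.mul_apply, hπσ_val, ih, Finset.image_image, ← Equiv.Perm.coe_mul, ← pow_succ']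
  have hσF_pow_val : ∀ (j : ℕ) (y : {y : V // ρ y = y}), ((σF ^ j) y).1 = (σ ^ j) y.1 := by
    intro j; induction j with
    | zero => intro y; rw [pow_zero, pow_zero, Equiv.Perm.one_apply, Equiv.Perm.one_apply]
    | succ j ih => intro y; rw [pow_succ', pow_succ', Equiv.Perm.mul_apply, Equiv.Perm.mul_apply, hσF_val, ih]
  -- matrices
  set B : Matrix {y : V // ρ y = y} ι ℚ := fun y i => (A y.1 (rep i) : ℚ) with hB
  set Jm : Matrix {y : V // ρ y = y} {y : V // ρ y = y} ℚ := Matrix.of fun _ _ => (1 : ℚ) with hJm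
  set K : Matrix {y : V // ρ y = y} {y : V // ρ y = y} ℚ := (1 / 7 : ℚ) • (1 - (1 / 26 : ℚ) • Jm) with hK
  set R : Matrix {y : V // ρ y = y} {y : V // ρ y = y} ℚ := Matrix.of fun a b => if σF a = b then (1 : ℚ) else 0 with hR
  set P : Matrix ι ι ℚ := Matrix.of fun a b => if πσ a = b then (1 : ℚ) else 0 with hP
  -- row constancy on orbits (fixed rows)
  have hrow : ∀ (y : {y : V // ρ y = y}) (z : V) (k : ℕ), A y.1 ((ρ ^ k) z) = A y.1 z := fun y z k =>
    aut_fixed_row_orbit_constant A ρ hAρ y.2 z k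
  -- B Bᵀ = 7 (1 + J)
  obtain ⟨-, -, hblk1, hblk2, -⟩ := aut_order11_fixed_block hV A h01 hsymm hdiag hk hsrg ρ hρ hρ1 hAρ
  have hsdiff : (univ \ univ.filter fun x : V => ρ x = x) = univ.filter fun x => ρ x ≠ x := by
    ext z; simp
  have hBBt : B * Bᵀ = (7 : ℚ) • (1 + Jm) := by
    ext y y'
    simp only [Matrix.mul_apply, Matrix.transpose_apply, hB, Matrix.smul_apply, Matrix.add_apply, Matrix.one_apply, hJm,
      Matrix.of_apply, smul_eq_mul]
    have hg := hsum (fun z => (A y.1 z : ℚ) * (A y'.1 z : ℚ)) (fun x k _ => by simp only [hrow])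
    by_cases hyy : y = y'
    · subst hyy
      rw [if_pos rfl]
      have h154 : ∑ z ∈ univ.filter (fun x => ρ x ≠ x), (A y.1 z : ℚ) * (A y.1 z : ℚ) = 154 := by
        have e : ∀ z, (A y.1 z : ℚ) * (A y.1 z : ℚ) = (A y.1 z : ℚ) := fun z => by
          rcases h01 y.1 z with h | h <;> simp [h]
        rw [Finset.sum_congr rfl fun z _ => e z, ← hsdiff]
        have := (hblk1 y.1 (Finset.mem_filter.mpr ⟨Finset.mem_univ _, y.2⟩)).1
        exact_mod_cast this
      rw [h154] at hg
      linarith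
    · rw [if_neg hyy]
      have hne : y.1 ≠ y'.1 := fun h => hyy (Subtype.ext h)
      have h77 : ∑ z ∈ univ.filter (fun x => ρ x ≠ x), (A y.1 z : ℚ) * (A y'.1 z : ℚ) = 77 := by
        rw [← hsdiff]
        have := (hblk2 y.1 (Finset.mem_filter.mpr ⟨Finset.mem_univ _, y.2⟩) y'.1
          (Finset.mem_filter.mpr ⟨Finset.mem_univ _, y'.2⟩) hne).1
        rw [Finset.sum_congr rfl fun z _ => by rw [hsymm z y'.1]]
        exact_mod_cast this
      rw [h77] at hg
      linarith
  -- J² = 25 J and B Bᵀ K = 1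
  have hJJ : Jm * Jm = (25 : ℚ) • Jm := by
    ext a b
    simp only [Matrix.mul_apply, hJm, Matrix.of_apply, Matrix.smul_apply, smul_eq_mul, mul_one, Finset.sum_const,
      Finset.card_univ, nsmul_eq_mul]
    rw [hFcard]; norm_num
  have hJinv : (1 + Jm) * (1 - (1 / 26 : ℚ) • Jm) = 1 := by
    rw [Matrix.add_mul, Matrix.one_mul, Matrix.mul_sub, Matrix.mul_one, Matrix.mul_smul, hJJ, smul_smul]
    ext a b
    simp only [Matrix.sub_apply, Matrix.add_apply, Matrix.one_apply, Matrix.smul_apply, hJm, Matrix.of_apply, smul_eq_mul]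
    split_ifs <;> norm_num
  have hBK : B * Bᵀ * K = 1 := by
    rw [hBBt, hK, Matrix.smul_mul, Matrix.mul_smul, smul_smul, hJinv]
    norm_num
  have hJt : Jmᵀ = Jm := by ext a b; rfl
  have hKt : Kᵀ = K := by
    rw [hK, Matrix.transpose_smul, Matrix.transpose_sub, Matrix.transpose_one, Matrix.transpose_smul, hJt]
  -- orthogonality, J-compatibility
  have hRtR : Rᵀ * R = 1 := by rw [hR]; exact perm01_transpose_mul_self σF
  have hPtP : Pᵀ * P = 1 := by rw [hP]; exact perm01_transpose_mul_self πσ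
  have hRK : R * K = K * R := by
    obtain ⟨hRJ, hJR⟩ := perm01_mul_allOnes σF
    rw [hK, Matrix.mul_smul, Matrix.smul_mul, Matrix.mul_sub, Matrix.sub_mul, Matrix.mul_one, Matrix.one_mul,
      Matrix.mul_smul, Matrix.smul_mul, hR, hJm, hRJ, hJR]
  -- intertwining B P = R B
  have hBP : B * P = R * B := by
    ext y j
    rw [hP, perm01_mul_right πσ B y j, hR, perm01_mul_left σF B y j]
    simp only [hB, hσF_val]
    set i₀ := πσ.symm j with hi₀
    have hval : (πσ i₀).1 = j.1 := by rw [hi₀, Equiv.apply_symm_apply]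
    rw [hπσ_val] at hval
    have hmem : σ (rep i₀) ∈ orb (rep j) := by
      rw [hrep_orb j, ← hval]; exact Finset.mem_image_of_mem _ (hrep_mem i₀)
    obtain ⟨k, -, hk'⟩ := Finset.mem_image.mp hmem
    have e1 : A y.1 (rep i₀) = A (σ y.1) (σ (rep i₀)) := (hAσ y.1 (rep i₀)).symm
    rw [e1, ← hk']
    have hσy : ρ (σ y.1) = σ y.1 := by rw [← hcx, y.2]
    exact_mod_cast aut_fixed_row_orbit_constant A ρ hAρ hσy (rep j) k
  -- P has finite order N
  have hπσN : πσ ^ N = 1 := by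
    refine Equiv.ext fun i => Subtype.ext ?_
    rw [hπσ_pow_val, hσN, Equiv.Perm.one_apply, Equiv.Perm.coe_one, Finset.image_id]
  have hPN : P ^ N = 1 := by
    rw [hP, perm01_pow, hπσN]
    ext a b
    simp only [Matrix.of_apply, Equiv.Perm.one_apply, Matrix.one_apply]
    split_ifs <;> rfl
  -- the abstract averaged test
  have hmain := trace_pow_sub_sum_nonneg_of_intertwining B K hBK hKt R P hRtR hPtP hRK hBP hN hPN
  -- identify the traces of the powers
  have htrP : ∀ j, trace (P ^ j) = ((univ.filter fun a : ι => (πσ ^ j) a = a).card : ℚ) := fun j => by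
    rw [hP, perm01_pow, perm01_trace]
  have htrR : ∀ j, trace (R ^ j) = ((univ.filter fun a : {y : V // ρ y = y} => (σF ^ j) a = a).card : ℚ) := fun j => by
    rw [hR, perm01_pow, perm01_trace]
  have hcountR : ∀ j, (univ.filter fun a : {y : V // ρ y = y} => (σF ^ j) a = a).card =
      (univ.filter fun x => (σ ^ j) x = x ∧ ρ x = x).card := fun j => by
    rw [← Fintype.card_subtype, ← Fintype.card_subtype]
    refine Fintype.card_congr ⟨fun a => ⟨a.1.1, ?_, a.1.2⟩, fun x => ⟨⟨x.1, x.2.2⟩, ?_⟩, fun a => rfl, fun x => rfl⟩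
    · have := congrArg Subtype.val a.2; rwa [hσF_pow_val] at this
    · exact Subtype.ext ((hσF_pow_val _ _).trans x.2.1)
  have hcountP : ∀ j, ((univ.filter fun x => ρ x ≠ x ∧ (σ ^ j) x ∈ orb x).card : ℚ) =
      11 * ((univ.filter fun a : ι => (πσ ^ j) a = a).card : ℚ) := fun j => by
    have hg := hsum (fun z => if (σ ^ j) z ∈ orb z then (1 : ℚ) else 0) (fun x k _ => by
      show (if (σ ^ j) ((ρ ^ k) x) ∈ orb ((ρ ^ k) x) then (1 : ℚ) else 0) = if (σ ^ j) x ∈ orb x then 1 else 0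
      rw [horb_pow, hckj]
      have : (ρ ^ k) ((σ ^ j) x) ∈ orb x ↔ (σ ^ j) x ∈ orb x := by
        rw [horb_mem, horb_mem, horb_pow]
      simp only [this])
    rw [Finset.sum_boole, Finset.sum_boole, Finset.filter_filter] at hg
    have hfix : (univ.filter fun i : ι => (σ ^ j) (rep i) ∈ orb (rep i)) = univ.filter fun a : ι => (πσ ^ j) a = a := by
      refine Finset.filter_congr fun i _ => ?_
      rw [horb_mem, horb_τ, hrep_orb, ← hπσ_pow_val]
      constructor
      · intro h; exact Subtype.ext h
      · intro h; rw [h]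
    rw [hfix] at hg
    exact hg
  have e : ∀ j, trace (P ^ j) - trace (R ^ j) =
      (1 / 11 : ℚ) * (((univ.filter fun x => ρ x ≠ x ∧ (σ ^ j) x ∈ orb x).card : ℚ)
        - 11 * ((univ.filter fun x => (σ ^ j) x = x ∧ ρ x = x).card : ℚ)) := fun j => by
    rw [htrP, htrR, hcountR, hcountP]
    ring
  rw [Finset.sum_congr rfl fun j _ => e j, ← Finset.mul_sum] at hmain
  have h' : (0 : ℚ) ≤ ∑ j ∈ Finset.range N, (((univ.filter fun x => ρ x ≠ x ∧ (σ ^ j) x ∈ orb x).card : ℚ)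
        - 11 * ((univ.filter fun x => (σ ^ j) x = x ∧ ρ x = x).card : ℚ)) := by
    linarith
  exact_mod_cast h'

end characterTest11

end Summit.Ventures.DiscreteObjects.Hadamard
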